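import Mathlib.Analysis.InnerProductSpace.Projection.Submodule
import Mathlib.Analysis.InnerProductSpace.Projection.FiniteDimensional
import Mathlib.Analysis.InnerProductSpace.Adjoint
import Mathlib.RepresentationTheory.Intertwining
import Mathlib.RepresentationTheory.Irreducible
import Mathlib.RepresentationTheory.Continuous.Basic
import Mathlib.Topology.Algebra.Module.FiniteDimension
import Literature.NumberTheory.Automorphic.HilbertRepSpectrum
import Literature.NumberTheory.Automorphic.GKModulesProofs
import HarnessLib

/-!
# `K`-finite vectors in the closure of an isotypic part of a unitary representation
(the Hilbert-space half of Harish-Chandra's `Cl(V') ∩ U' = V'`)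

Topic `NumberTheory/Automorphic`; support file for `AutomorphicRepsGLCuspidalL2Step3b` (Step 3b of
Borel–Jacquet 1979, 4.6 for `GL_n`: a `K`-finite vector in the closure of a stable subspace of the
`K`-finite vectors of an admissible unitary representation already lies in that subspace;
Harish-Chandra 1953, Thm. 5; Libine 2012 (Schmid's course), Lemma 74 "`(W̄)_fini = W`"). In print
this uses the `K`-isotypic projectors `∫_K \overline{χ_τ}(k) π(k) dk`; here the same conclusions are
obtained WITHOUT Haar measure or characters, from orthogonal projections and finite-dimensional
unitary representation theory only. Everything is proved; nothing is vendored.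

For a group `K` acting unitarily on a complex Hilbert space `H` (`σ : ContRepresentation ℂ K H`,
`σ.IsUnitary`) and a finite-dimensional representation `τ` of `K`:

* `Representation.homRangeSum ρ τ` — for any representation `ρ` of `K`: the sum of the images of
  all `K`-maps `τ → ρ` (the "`τ`-part" of `ρ`; for irreducible `τ` the `τ`-isotypic subspace).
  `FiniteDimensional` as soon as `Hom_K(τ, ρ)` and `τ` are (`finiteDimensional_homRangeSum`).
* `ContRepresentation.subRep σ F hF` — the representation of `K` on a `σ`-stable subspace `F ≤ H`;
  `ContRepresentation.tauPart σ τ F hF ≤ F` — the `τ`-part of `F`, pushed into `H`.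
* **Decomposition** (`exists_tauPart_add_orthogonal`): a finite-dimensional `σ`-stable `F` splits
  every `w ∈ F` as `w = s + d` with `s` in the `τ`-part of `F` and `d ∈ F` orthogonal to the
  `τ`-part of ALL of `H` (the `K`-equivariant orthogonal projection onto `F ⊖ (τ-part of F)`
  composed with a `K`-map `τ → H` is a `K`-map `τ → F`, hence lands in the `τ`-part, hence is `0`).
* Consequences: the orthogonal projection `q` onto the CLOSURE of the `τ`-part of `H` maps `w ∈ F`
  into the `τ`-part of `F` (`starProjection_closure_homRangeSum_mem_tauPart`), in particular
  `q(F) ⊆ F`; and if `F` lies in that closure then `F` equals its own `τ`-part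
  (`mem_tauPart_of_le_closure`): `K`-finite vectors in the closure of the `τ`-part are algebraic.
* `IsUnitary.starProjection_map_eq` — the orthogonal projection onto a closed `σ`-stable subspace
  commutes with `σ`; `IsUnitary.starProjection_invariants_mem` — the orthogonal projection onto the
  fixed vectors `σ.invariants` maps every closed `σ`-stable subspace into itself;
  `map_homRangeSum_le_of_commute` — operators commuting with `σ(K)` preserve the `τ`-part.
* `finiteDimensional_intertwiningMap_of_irreducible` — if every IRREDUCIBLE finite-dimensional
  `σ`-stable `E ≤ H` has `dim Hom_K(E, ρ) < ∞` (admissibility of `ρ` tested on the `K`-types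
  occurring in `H`), then `dim Hom_K(F, ρ) < ∞` for EVERY finite-dimensional `σ`-stable `F ≤ H`
  (induction on `dim F`: a minimal stable subspace is irreducible, its orthogonal complement in `F`
  is stable, and restriction to the two pieces is jointly injective).

## Design notes

* Namespaces. Everything here is declared into Mathlib's namespaces `Representation`
  (`homRangeSum` and its lemmas, for a bare `Representation ℂ K V`) and `ContRepresentation`
  (`subRep`, `subRepSubtype`, `subRepInclusion`, `orbitSpan`, `tauPart`, the `CompleteSpace`
  instance on `σ.invariants`, and the `IsUnitary.…` lemmas) as DELIBERATE dot-notation extensions of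
  Mathlib's structures `Representation` / `ContRepresentation` (and of the tree's predicate
  `ContRepresentation.IsUnitary` of `HilbertRepSpectrum`), exactly as `HilbertRepSpectrum`,
  `HeckeEigenvectorProjection` and `DiscreteDecompositionCriterion` do (lean/CONVENTIONS.md §2);
  nothing else is added to those namespaces.
* `IsUnitary.apply_mem_orthogonal` and `IsUnitary.starProjection_map_eq` are the `Submodule`-level
  forms of the landed `ContRepresentation.ClosedSubrep.orthogonal` (`HilbertRepSpectrum`) and
  `ContRepresentation.ClosedSubrep.orthogonalProjectionOnto_map_apply`
  (`HeckeEigenvectorProjection`; the same computation is inlined in `HilbertRepSpectrumProofs`):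
  here the subspace is any submodule with `[HasOrthogonalProjection]` and a stability hypothesis
  (no `ClosedSubrep` packaging), which is the generality the finite-dimensional pieces `S`, `D`,
  `E'` of the proofs below require.
* `Representation.homRangeSum ρ τ` is, for irreducible `τ`, the representation-level counterpart
  of Mathlib's module-level `isotypicComponent` (`Mathlib/RingTheory/SimpleModule/Isotypic`, via
  `Representation.asModule`); the present form is the one usable on `Submodule ℂ H` and
  `ContRepresentation`, and for reducible `τ` (the orbit span of a `K`-finite vector) it is what
  the proofs consume.

## References

* Harish-Chandra, *Representations of a semisimple Lie group on a Banach space. I*, Trans. AMS 75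
  (1953), Thm. 5 (p. 228) and Lemma 33 [HarishChandraTAMS1953].
* M. Libine, *Introduction to Representations of Real Semisimple Lie Groups*, arXiv:1212.2578,
  Lemma 74 [Libine2012].
* N. R. Wallach, *Real Reductive Groups I* (1988), §1.4.6–1.4.7, §3.3.1 [WallachRRG1].
* J. Dixmier, *C\*-algebras* (1977), §13.1.2 [Dixmier1977].
-/

noncomputable section

open scoped InnerProductSpace ComplexConjugate

/-! ## The `τ`-part of a representation: images of the `K`-maps from `τ` -/

namespace Representation

variable {K : Type*} [Group K] {V : Type*} [AddCommGroup V] [Module ℂ V]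
  {W : Type*} [AddCommGroup W] [Module ℂ W]

/-- The **`τ`-part** of a representation `ρ` of `K`: the sum of the images `T(W)` of all
intertwining maps `T : τ → ρ`. For irreducible `τ` this is the `τ`-isotypic subspace `V(τ)`
(Mathlib's module-level `isotypicComponent` under `Representation.asModule`); for semisimple `τ`
(e.g. `K` compact and `τ` finite-dimensional unitary) it is the sum of the isotypic subspaces of
the irreducible constituents of `τ`. Wallach, *Real Reductive Groups I*, §1.4.7 and §3.3.1
(`V(γ)`). [cite: WallachRRG1, §1.4.7] -/
def homRangeSum (ρ : Representation ℂ K V) (τ : Representation ℂ K W) : Submodule ℂ V :=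
  ⨆ T : τ.IntertwiningMap ρ, LinearMap.range T.toLinearMap

variable {ρ : Representation ℂ K V} {τ : Representation ℂ K W}

/-- `T w` lies in the `τ`-part for every `K`-map `T : τ → ρ`. [folklore] -/
theorem apply_mem_homRangeSum (T : τ.IntertwiningMap ρ) (w : W) : T w ∈ homRangeSum ρ τ :=
  Submodule.mem_iSup_of_mem T ⟨w, rfl⟩

/-- The range of a `K`-map `τ → ρ` lies in the `τ`-part. [folklore] -/
theorem range_le_homRangeSum (T : τ.IntertwiningMap ρ) :
    LinearMap.range T.toLinearMap ≤ homRangeSum ρ τ :=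
  le_iSup (fun T : τ.IntertwiningMap ρ ↦ LinearMap.range T.toLinearMap) T

/-- The `τ`-part is `K`-stable. Wallach, §1.4.7. [folklore] -/
theorem apply_mem_homRangeSum_of_mem (k : K) {v : V} (hv : v ∈ homRangeSum ρ τ) :
    ρ k v ∈ homRangeSum ρ τ := by
  induction hv using Submodule.iSup_induction' with
  | mem T v hv =>
    obtain ⟨w, rfl⟩ := hv
    have h : ρ k (T w) = T (τ k w) :=
      (Representation.IntertwiningMap.isIntertwining τ ρ T k w).symm
    rw [Representation.IntertwiningMap.toLinearMap_apply, h]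
    exact apply_mem_homRangeSum T (τ k w)
  | zero => simp
  | add v v' _ _ hv hv' =>
    rw [map_add]
    exact Submodule.add_mem _ hv hv'

/-- Functoriality: a `K`-map `S : ρ → ρ'` maps the `τ`-part of `ρ` into the `τ`-part of `ρ'`
(`S ∘ T` is a `K`-map `τ → ρ'`). [folklore] -/
theorem map_homRangeSum_le {V' : Type*} [AddCommGroup V'] [Module ℂ V']
    {ρ' : Representation ℂ K V'} (S : ρ.IntertwiningMap ρ') :
    (homRangeSum ρ τ).map S.toLinearMap ≤ homRangeSum ρ' τ := by
  refine Submodule.map_le_iff_le_comap.mpr (iSup_le fun T ↦ ?_)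
  rintro _ ⟨w, rfl⟩
  exact apply_mem_homRangeSum (S.comp T) w

/-- A linear endomorphism commuting with `ρ(K)` maps the `τ`-part into itself. [folklore] -/
theorem map_homRangeSum_le_of_commute (u : V →ₗ[ℂ] V) (hu : ∀ k, u ∘ₗ ρ k = ρ k ∘ₗ u) :
    (homRangeSum ρ τ).map u ≤ homRangeSum ρ τ :=
  map_homRangeSum_le (⟨u, hu⟩ : ρ.IntertwiningMap ρ)

/-- **Finite multiplicity gives a finite-dimensional `τ`-part**: if `Hom_K(τ, ρ)` and `τ` are
finite-dimensional, so is the `τ`-part of `ρ` (it is spanned by the values `T (b i)` on a basis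
`b` of `τ`). Wallach, §3.3.1. [folklore] -/
theorem finiteDimensional_homRangeSum [FiniteDimensional ℂ W]
    [FiniteDimensional ℂ (τ.IntertwiningMap ρ)] : FiniteDimensional ℂ (homRangeSum ρ τ) := by
  classical
  let b := Module.finBasis ℂ W
  let ev : Fin (Module.finrank ℂ W) → (τ.IntertwiningMap ρ →ₗ[ℂ] V) := fun i ↦
    { toFun := fun T ↦ T (b i)
      map_add' := fun _ _ ↦ rfl
      map_smul' := fun _ _ ↦ rfl }
  have hle : homRangeSum ρ τ ≤ ⨆ i, LinearMap.range (ev i) := by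
    refine iSup_le fun T ↦ ?_
    rintro _ ⟨w, rfl⟩
    rw [Representation.IntertwiningMap.toLinearMap_apply, ← b.sum_repr w, map_sum]
    refine Submodule.sum_mem _ fun i _ ↦ ?_
    rw [map_smul]
    exact Submodule.smul_mem _ _ (Submodule.mem_iSup_of_mem i ⟨T, rfl⟩)
  exact Submodule.finiteDimensional_of_le hle

end Representation

/-! ## Unitary actions on a Hilbert space -/

namespace ContRepresentation

variable {K : Type*} [Group K] {H : Type*} [NormedAddCommGroup H] [InnerProductSpace ℂ H]
  (σ : ContRepresentation ℂ K H)

/-- The representation of `K` on a `σ`-stable subspace `F ≤ H`, by restriction (Mathlib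
`Subrepresentation.toRepresentation` of `⟨F, hF⟩`). Dixmier 1977, §13.1.2. [cite: Dixmier1977, §13.1.2] -/
abbrev subRep (F : Submodule ℂ H) (hF : ∀ k, ∀ v ∈ F, σ k v ∈ F) : Representation ℂ K F :=
  (⟨F, fun k _ hv ↦ hF k _ hv⟩ : Subrepresentation σ.toRepresentation).toRepresentation

/-- `σ.subRep F hF k v = σ k v` in `H`. [folklore] -/
@[simp]
theorem coe_subRep_apply (F : Submodule ℂ H) (hF : ∀ k, ∀ v ∈ F, σ k v ∈ F) (k : K) (v : F) :
    (σ.subRep F hF k v : H) = σ k v := rfl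

/-- The inclusion of a stable subspace is a `K`-map `σ|_F → σ`. [folklore] -/
def subRepSubtype (F : Submodule ℂ H) (hF : ∀ k, ∀ v ∈ F, σ k v ∈ F) :
    (σ.subRep F hF).IntertwiningMap σ.toRepresentation where
  toLinearMap := F.subtype
  isIntertwining' k := by ext v; rfl

/-- The inclusion `K`-map is the identity on vectors. [folklore] -/
@[simp]
theorem subRepSubtype_apply (F : Submodule ℂ H) (hF : ∀ k, ∀ v ∈ F, σ k v ∈ F) (v : F) :
    σ.subRepSubtype F hF v = v := rfl

/-- The inclusion `F ≤ F'` of stable subspaces is a `K`-map `σ|_F → σ|_{F'}`. [folklore] -/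
def subRepInclusion {F F' : Submodule ℂ H} (hF : ∀ k, ∀ v ∈ F, σ k v ∈ F)
    (hF' : ∀ k, ∀ v ∈ F', σ k v ∈ F') (h : F ≤ F') :
    (σ.subRep F hF).IntertwiningMap (σ.subRep F' hF') where
  toLinearMap := Submodule.inclusion h
  isIntertwining' k := by ext v; rfl

/-- The inclusion `K`-map `σ|_F → σ|_{F'}` is the identity on vectors. [folklore] -/
@[simp]
theorem coe_subRepInclusion_apply {F F' : Submodule ℂ H} (hF : ∀ k, ∀ v ∈ F, σ k v ∈ F)
    (hF' : ∀ k, ∀ v ∈ F', σ k v ∈ F') (h : F ≤ F') (v : F) :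
    (σ.subRepInclusion hF hF' h v : H) = v := rfl


/-! ### Orbit spans -/

/-- The span of the `K`-orbit `{σ k x}` of a vector `x`: the smallest `σ`-stable subspace
containing `x` (`x` is `K`-finite iff it is finite-dimensional). Wallach, §1.4.6. [folklore] -/
def orbitSpan (x : H) : Submodule ℂ H := Submodule.span ℂ (Set.range fun k : K ↦ σ k x)

/-- `x` lies in the span of its orbit (`k = 1`). [folklore] -/
theorem mem_orbitSpan_self (x : H) : x ∈ σ.orbitSpan x :=
  Submodule.subset_span ⟨1, by simp⟩

/-- `σ k x` lies in the span of the orbit of `x`. [folklore] -/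
theorem apply_mem_orbitSpan (k : K) (x : H) : σ k x ∈ σ.orbitSpan x :=
  Submodule.subset_span ⟨k, rfl⟩

/-- The orbit span is `σ`-stable. [folklore] -/
theorem apply_mem_orbitSpan_of_mem (k : K) {x v : H} (hv : v ∈ σ.orbitSpan x) :
    σ k v ∈ σ.orbitSpan x := by
  induction hv using Submodule.span_induction with
  | mem _ h =>
    obtain ⟨k', rfl⟩ := h
    have : σ k (σ k' x) = σ (k * k') x := by rw [map_mul]; rfl
    rw [this]
    exact σ.apply_mem_orbitSpan _ x
  | zero => rw [map_zero]; exact Submodule.zero_mem _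
  | add _ _ _ _ h₁ h₂ => rw [map_add]; exact Submodule.add_mem _ h₁ h₂
  | smul c _ _ h => rw [map_smul]; exact Submodule.smul_mem _ c h

/-- The orbit span of `x` lies in every `σ`-stable subspace containing `x`. [folklore] -/
theorem orbitSpan_le {x : H} {S : Submodule ℂ H} (hS : ∀ k, ∀ v ∈ S, σ k v ∈ S) (hx : x ∈ S) :
    σ.orbitSpan x ≤ S := by
  refine Submodule.span_le.mpr ?_
  rintro _ ⟨k, rfl⟩
  exact hS k x hx

/-- The orbit span is spanned by a finite set as soon as the orbit is finite, hence is then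
finite-dimensional. [folklore] -/
theorem finiteDimensional_orbitSpan_of_finite {x : H} (h : (Set.range fun k : K ↦ σ k x).Finite) :
    FiniteDimensional ℂ (σ.orbitSpan x) :=
  FiniteDimensional.span_of_finite ℂ h

/-- The **`τ`-part of a stable subspace `F`**, as a subspace of `H`: the sum of the images of the
`K`-maps `τ → σ|_F`. Wallach, §1.4.7. [cite: WallachRRG1, §1.4.7] -/
def tauPart {W : Type*} [AddCommGroup W] [Module ℂ W] (τ : Representation ℂ K W)
    (F : Submodule ℂ H) (hF : ∀ k, ∀ v ∈ F, σ k v ∈ F) : Submodule ℂ H :=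
  (Representation.homRangeSum (σ.subRep F hF) τ).map F.subtype

variable {σ} {W : Type*} [AddCommGroup W] [Module ℂ W] {τ : Representation ℂ K W}

/-- The `τ`-part of `F` lies in `F`. [folklore] -/
theorem tauPart_le {F : Submodule ℂ H} (hF : ∀ k, ∀ v ∈ F, σ k v ∈ F) : σ.tauPart τ F hF ≤ F := by
  rintro _ ⟨v, -, rfl⟩
  exact v.2

/-- The `τ`-part of `F` lies in the `τ`-part of `H`. [folklore] -/
theorem tauPart_le_homRangeSum {F : Submodule ℂ H} (hF : ∀ k, ∀ v ∈ F, σ k v ∈ F) :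
    σ.tauPart τ F hF ≤ Representation.homRangeSum σ.toRepresentation τ :=
  Representation.map_homRangeSum_le (σ.subRepSubtype F hF)

/-- The `τ`-part is monotone in the stable subspace. [folklore] -/
theorem tauPart_mono {F F' : Submodule ℂ H} (hF : ∀ k, ∀ v ∈ F, σ k v ∈ F)
    (hF' : ∀ k, ∀ v ∈ F', σ k v ∈ F') (h : F ≤ F') : σ.tauPart τ F hF ≤ σ.tauPart τ F' hF' := by
  rintro _ ⟨v, hv, rfl⟩
  have hv' : σ.subRepInclusion hF hF' h v ∈ Representation.homRangeSum (σ.subRep F' hF') τ :=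
    Representation.map_homRangeSum_le (σ.subRepInclusion hF hF' h) (Submodule.mem_map_of_mem hv)
  exact ⟨_, hv', rfl⟩

/-- The image of a `K`-map `τ → σ|_F` lies in the `τ`-part of `F`. [folklore] -/
theorem apply_mem_tauPart {F : Submodule ℂ H} (hF : ∀ k, ∀ v ∈ F, σ k v ∈ F)
    (T : τ.IntertwiningMap (σ.subRep F hF)) (w : W) : (T w : H) ∈ σ.tauPart τ F hF :=
  ⟨T w, Representation.apply_mem_homRangeSum T w, rfl⟩

/-- The `τ`-part of `F` is `K`-stable. [folklore] -/
theorem apply_mem_tauPart_of_mem {F : Submodule ℂ H} (hF : ∀ k, ∀ v ∈ F, σ k v ∈ F) (k : K)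
    {v : H} (hv : v ∈ σ.tauPart τ F hF) : σ k v ∈ σ.tauPart τ F hF := by
  obtain ⟨v, hv, rfl⟩ := hv
  exact ⟨σ.subRep F hF k v, Representation.apply_mem_homRangeSum_of_mem k hv, rfl⟩

/-- If `dim Hom_K(τ, σ|_F) < ∞` and `dim τ < ∞` then the `τ`-part of `F` is finite-dimensional.
Wallach, §3.3.1. [folklore] -/
theorem finiteDimensional_tauPart [FiniteDimensional ℂ W] {F : Submodule ℂ H}
    (hF : ∀ k, ∀ v ∈ F, σ k v ∈ F) [FiniteDimensional ℂ (τ.IntertwiningMap (σ.subRep F hF))] :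
    FiniteDimensional ℂ (σ.tauPart τ F hF) := by
  haveI := Representation.finiteDimensional_homRangeSum (ρ := σ.subRep F hF) (τ := τ)
  unfold tauPart
  infer_instance

/-! ### Unitarity: stable subspaces have stable orthogonal complements -/

variable [CompleteSpace H]

/-- For unitary `σ`, the orthogonal complement of a `σ`-stable subspace is `σ`-stable:
`⟪u, σ k v⟫ = ⟪σ k⁻¹ u, v⟫ = 0`. `Submodule`-level form of the landed
`ContRepresentation.ClosedSubrep.orthogonal` (`HilbertRepSpectrum`), for an arbitrary stable
submodule (no closedness needed). Dixmier 1977, §13.1.2. [cite: Dixmier1977, §13.1.2] -/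
theorem IsUnitary.apply_mem_orthogonal (hσ : σ.IsUnitary) {F : Submodule ℂ H}
    (hF : ∀ k, ∀ v ∈ F, σ k v ∈ F) (k : K) {v : H} (hv : v ∈ Fᗮ) : σ k v ∈ Fᗮ := by
  rw [Submodule.mem_orthogonal] at hv ⊢
  intro u hu
  rw [← ContinuousLinearMap.adjoint_inner_left, hσ.adjoint_apply k]
  exact hv _ (hF k⁻¹ u hu)

/-- **The orthogonal projection onto a closed stable subspace commutes with a unitary action.**
`Submodule`-level form (any `[HasOrthogonalProjection]` submodule with a stability hypothesis) of
the landed `ContRepresentation.ClosedSubrep.orthogonalProjectionOnto_map_apply`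
(`HeckeEigenvectorProjection`; also inlined in `HilbertRepSpectrumProofs`), needed below for
finite-dimensional pieces that are not packaged as `ClosedSubrep`s. Dixmier 1977, §13.1.2. [cite: Dixmier1977, §13.1.2] -/
theorem IsUnitary.starProjection_map_eq (hσ : σ.IsUnitary) {M : Submodule ℂ H}
    [M.HasOrthogonalProjection] (hM : ∀ k, ∀ v ∈ M, σ k v ∈ M) (k : K) (v : H) :
    M.starProjection (σ k v) = σ k (M.starProjection v) := by
  refine Submodule.eq_starProjection_of_mem_orthogonal (hM k _ (M.starProjection_apply_mem v)) ?_
  rw [← map_sub]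
  exact hσ.apply_mem_orthogonal hM k (M.sub_starProjection_mem_orthogonal v)

omit [CompleteSpace H] in
/-- The fixed vectors `σ.invariants` form a closed subspace. [folklore] -/
theorem isClosed_invariants : IsClosed (σ.invariants : Set H) := by
  have : (σ.invariants : Set H) = ⋂ k : K, {v | σ k v = v} := by
    ext v
    simp [ContRepresentation.mem_invariants]
  rw [this]
  exact isClosed_iInter fun k ↦ isClosed_eq (σ k).continuous continuous_id

/-- The fixed vectors of a representation on a Hilbert space form a complete (closed) subspace, so
that the orthogonal projection onto them is available. [folklore] -/
instance : CompleteSpace σ.invariants := σ.isClosed_invariants.completeSpace_coe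

/-- **The orthogonal projection onto the fixed vectors maps every closed stable subspace into
itself** (unitary `σ`): for `w ∈ V`, the projection of `w` onto `V ∩ H^K` is already the
projection onto `H^K`, because for `z ∈ H^K` the `V`-component of `z` is again fixed.
(For a compact group this is the averaging operator `∫_K σ(k) dk`; no Haar measure is used here.)
Dixmier 1977, §13.1.2; Wallach, §1.4.6. [folklore] -/
theorem IsUnitary.starProjection_invariants_mem (hσ : σ.IsUnitary) {V : Submodule ℂ H}
    (hVc : IsClosed (V : Set H)) (hV : ∀ k, ∀ v ∈ V, σ k v ∈ V) {w : H} (hw : w ∈ V) :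
    σ.invariants.starProjection w ∈ V := by
  haveI : CompleteSpace V := hVc.completeSpace_coe
  haveI : CompleteSpace ↥(V ⊓ σ.invariants) :=
    (hVc.inter σ.isClosed_invariants).completeSpace_coe
  set a := (V ⊓ σ.invariants).starProjection w with ha
  have haV : a ∈ V := ((V ⊓ σ.invariants).starProjection_apply_mem w).1
  have haI : a ∈ σ.invariants := ((V ⊓ σ.invariants).starProjection_apply_mem w).2
  suffices h : σ.invariants.starProjection w = a by rw [h]; exact haV
  refine Submodule.eq_starProjection_of_mem_orthogonal haI ?_
  rw [Submodule.mem_orthogonal]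
  intro z hz
  -- decompose `z = z₁ + z₂` along `V ⊕ Vᗮ`; `z₁` is again fixed
  set z₁ := V.starProjection z with hz₁
  have hz₁V : z₁ ∈ V := V.starProjection_apply_mem z
  have hz₁I : z₁ ∈ σ.invariants := by
    rw [ContRepresentation.mem_invariants]
    intro k
    have := hσ.starProjection_map_eq hV k z
    rw [(ContRepresentation.mem_invariants z).mp hz k] at this
    exact this.symm
  have hz₂ : z - z₁ ∈ Vᗮ := V.sub_starProjection_mem_orthogonal z
  have h1 : ⟪z₁, w - a⟫_ℂ = 0 :=
    Submodule.inner_right_of_mem_orthogonal (K := V ⊓ σ.invariants) ⟨hz₁V, hz₁I⟩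
      ((V ⊓ σ.invariants).sub_starProjection_mem_orthogonal w)
  have h2 : ⟪z - z₁, w - a⟫_ℂ = 0 :=
    Submodule.inner_left_of_mem_orthogonal (K := V) (V.sub_mem hw haV) hz₂
  calc ⟪z, w - a⟫_ℂ = ⟪z₁ + (z - z₁), w - a⟫_ℂ := by rw [add_sub_cancel]
    _ = 0 := by rw [inner_add_left, h1, h2, add_zero]

/-! ### The decomposition of a finite-dimensional stable subspace along `τ` -/

/-- **Decomposition along `τ`.** Let `σ` be unitary and `F ≤ H` a finite-dimensional `σ`-stable
subspace. Every `w ∈ F` is `w = s + d` with `s` in the `τ`-part of `F` and `d ∈ F` orthogonal to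
the `τ`-part of the whole of `H`. Proof: `s` is the orthogonal projection of `w` onto the `τ`-part
`S` of `F` and `d = w - s ∈ D := F ⊓ Sᗮ`, a `σ`-stable subspace; for a `K`-map `T : τ → H`, the
composite of `T` with the (equivariant) orthogonal projection onto `D` is a `K`-map `τ → F`, so its
image lies in `S ∩ D = 0`; hence `T(W) ⊥ D`. (Orthogonality of distinct `K`-types, Schur; Wallach,
§1.4.6–1.4.7; Libine 2012, Lemma 74.) [cite: WallachRRG1, §1.4.7] -/
theorem IsUnitary.exists_tauPart_add_orthogonal (hσ : σ.IsUnitary) {F : Submodule ℂ H}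
    [FiniteDimensional ℂ F] (hF : ∀ k, ∀ v ∈ F, σ k v ∈ F) {w : H} (hw : w ∈ F) :
    ∃ s ∈ σ.tauPart τ F hF, ∃ d ∈ F,
      w = s + d ∧ d ∈ (Representation.homRangeSum σ.toRepresentation τ)ᗮ := by
  set S := σ.tauPart τ F hF with hS_def
  have hSF : S ≤ F := tauPart_le hF
  haveI : FiniteDimensional ℂ S := Submodule.finiteDimensional_of_le hSF
  have hSK : ∀ k, ∀ v ∈ S, σ k v ∈ S := fun k v hv ↦ apply_mem_tauPart_of_mem hF k hv
  -- the complement `D = F ⊓ Sᗮ`, stable and finite-dimensional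
  set D : Submodule ℂ H := F ⊓ Sᗮ with hD_def
  haveI : FiniteDimensional ℂ D := Submodule.finiteDimensional_of_le (inf_le_left : D ≤ F)
  have hDK : ∀ k, ∀ v ∈ D, σ k v ∈ D := fun k v hv ↦
    ⟨hF k v hv.1, hσ.apply_mem_orthogonal hSK k hv.2⟩
  refine ⟨S.starProjection w, S.starProjection_apply_mem w, w - S.starProjection w,
    F.sub_mem hw (hSF (S.starProjection_apply_mem w)), (add_sub_cancel _ _).symm, ?_⟩
  have hdD : w - S.starProjection w ∈ D := ⟨F.sub_mem hw (hSF (S.starProjection_apply_mem w)),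
    S.sub_starProjection_mem_orthogonal w⟩
  -- every `K`-map `τ → H` has image orthogonal to `D`
  suffices key : ∀ (T : τ.IntertwiningMap σ.toRepresentation) (x : W), (T x : H) ∈ Dᗮ by
    rw [Submodule.mem_orthogonal]
    intro y hy
    induction hy using Submodule.iSup_induction' with
    | mem T y hy =>
      obtain ⟨x, rfl⟩ := hy
      exact Submodule.inner_left_of_mem_orthogonal (K := D) hdD (key T x)
    | zero => exact inner_zero_left _
    | add y y' _ _ hy hy' => rw [inner_add_left, hy, hy', add_zero]
  intro T x
  -- the equivariant projection onto `D` composed with `T` is a `K`-map `τ → F`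
  let T' : τ.IntertwiningMap (σ.subRep F hF) :=
    { toLinearMap := (LinearMap.codRestrict F (D.starProjection.toLinearMap ∘ₗ T.toLinearMap)
        fun x ↦ (D.starProjection_apply_mem (T x)).1)
      isIntertwining' := fun k ↦ by
        refine LinearMap.ext fun y ↦ Subtype.ext ?_
        change D.starProjection (T (τ k y)) = σ k (D.starProjection (T y))
        have hT : T (τ k y) = σ k (T y) :=
          Representation.IntertwiningMap.isIntertwining τ σ.toRepresentation T k y
        rw [hT]
        exact hσ.starProjection_map_eq hDK k (T y) }
  have hmemS : D.starProjection (T x) ∈ S := apply_mem_tauPart hF T' x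
  have hmemD : D.starProjection (T x) ∈ D := D.starProjection_apply_mem (T x)
  have h0 : D.starProjection (T x) = 0 := by
    have : D.starProjection (T x) ∈ S ⊓ Sᗮ := ⟨hmemS, hmemD.2⟩
    rwa [Submodule.inf_orthogonal_eq_bot, Submodule.mem_bot] at this
  exact (Submodule.starProjection_apply_eq_zero_iff D).mp h0

/-- **The orthogonal projection onto the closure of the `τ`-part of `H` maps a finite-dimensional
stable `F` into the `τ`-part of `F`** (in particular into `F`): with `w = s + d` as in
`exists_tauPart_add_orthogonal`, `s` lies in the closure and `d` is orthogonal to it.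
Harish-Chandra 1953, Thm. 5 (the projectors `E_𝔡` preserve `U'`); Libine 2012, Lemma 74. [cite: Libine2012, Lemma 74] -/
theorem IsUnitary.starProjection_closure_homRangeSum_mem_tauPart (hσ : σ.IsUnitary)
    {F : Submodule ℂ H} [FiniteDimensional ℂ F] (hF : ∀ k, ∀ v ∈ F, σ k v ∈ F) {w : H}
    (hw : w ∈ F) :
    (Representation.homRangeSum σ.toRepresentation τ).topologicalClosure.starProjection w ∈
      σ.tauPart τ F hF := by
  obtain ⟨s, hs, d, -, rfl, hd⟩ := hσ.exists_tauPart_add_orthogonal (τ := τ) hF hw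
  have h : (Representation.homRangeSum σ.toRepresentation τ).topologicalClosure.starProjection
      (s + d) = s := by
    refine Submodule.eq_starProjection_of_mem_orthogonal
      (Submodule.le_topologicalClosure _ (tauPart_le_homRangeSum hF hs)) ?_
    rw [add_sub_cancel_left, Submodule.orthogonal_closure]
    exact hd
  rw [h]
  exact hs

/-- **`K`-finite vectors in the closure of the `τ`-part are algebraic**: if a finite-dimensional
stable `F` lies in the closure of the `τ`-part of `H`, then every `w ∈ F` lies in the `τ`-part of
`F` itself (the component `d` of `w = s + d` lies in the closure and is orthogonal to it).
Harish-Chandra 1953, Thm. 5 (`Cl(V') ∩ U' = V'`); Libine 2012, Lemma 74 (`(W̄)_fini = W`). [cite: HarishChandraTAMS1953, Thm. 5] -/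
theorem IsUnitary.mem_tauPart_of_le_closure (hσ : σ.IsUnitary) {F : Submodule ℂ H}
    [FiniteDimensional ℂ F] (hF : ∀ k, ∀ v ∈ F, σ k v ∈ F)
    (hFle : F ≤ (Representation.homRangeSum σ.toRepresentation τ).topologicalClosure) {w : H}
    (hw : w ∈ F) : w ∈ σ.tauPart τ F hF := by
  obtain ⟨s, hs, d, hdF, rfl, hd⟩ := hσ.exists_tauPart_add_orthogonal (τ := τ) hF hw
  have hd0 : d = 0 := by
    have h1 : d ∈ (Representation.homRangeSum σ.toRepresentation τ).topologicalClosure := hFle hdF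
    rw [← Submodule.orthogonal_closure] at hd
    have : d ∈ (Representation.homRangeSum σ.toRepresentation τ).topologicalClosure ⊓
        (Representation.homRangeSum σ.toRepresentation τ).topologicalClosureᗮ := ⟨h1, hd⟩
    rwa [Submodule.inf_orthogonal_eq_bot, Submodule.mem_bot] at this
  rw [hd0, add_zero]
  exact hs

/-! ### Operators commuting with `σ(K)` -/

omit [CompleteSpace H] in
/-- An operator commuting with `σ(K)` maps the closure of the `τ`-part of `H` into itself
(it maps the `τ`-part into itself and is continuous). [folklore] -/
theorem map_closure_homRangeSum_le_of_commute (u : H →L[ℂ] H) (hu : ∀ k, u ∘L σ k = σ k ∘L u) :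
    (Representation.homRangeSum σ.toRepresentation τ).topologicalClosure.map (u : H →ₗ[ℂ] H) ≤
      (Representation.homRangeSum σ.toRepresentation τ).topologicalClosure := by
  have h : (Representation.homRangeSum σ.toRepresentation τ).map (u : H →ₗ[ℂ] H) ≤
      Representation.homRangeSum σ.toRepresentation τ :=
    Representation.map_homRangeSum_le_of_commute (u : H →ₗ[ℂ] H) fun k ↦ by
      ext v
      exact congrArg (fun f : H →L[ℂ] H ↦ f v) (hu k)
  exact (Submodule.topologicalClosure_map u _).trans (Submodule.topologicalClosure_mono h)

omit [CompleteSpace H] in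
/-- The closure of the `τ`-part of `H` is `σ`-stable (the `τ`-part is, and `σ k` is continuous). [folklore] -/
theorem apply_mem_closure_homRangeSum (k : K) {v : H}
    (hv : v ∈ (Representation.homRangeSum σ.toRepresentation τ).topologicalClosure) :
    σ k v ∈ (Representation.homRangeSum σ.toRepresentation τ).topologicalClosure := by
  have h : (Representation.homRangeSum σ.toRepresentation τ).map (σ k : H →ₗ[ℂ] H) ≤
      Representation.homRangeSum σ.toRepresentation τ := by
    rintro _ ⟨u, hu, rfl⟩
    exact Representation.apply_mem_homRangeSum_of_mem k hu
  exact ((Submodule.topologicalClosure_map (σ k) _).trans (Submodule.topologicalClosure_mono h))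
    ⟨v, hv, rfl⟩

/-! ### Finite multiplicities for all finite-dimensional stable subspaces -/

omit [CompleteSpace H] in
/-- A minimal non-zero stable subspace carries an irreducible representation. Wallach, §1.4.6. [folklore] -/
theorem isIrreducible_subRep_of_minimal {E : Submodule ℂ H} (hE : ∀ k, ∀ v ∈ E, σ k v ∈ E)
    (hne : E ≠ ⊥)
    (hmin : ∀ U : Submodule ℂ H, (∀ k, ∀ u ∈ U, σ k u ∈ U) → U ≤ E → U = ⊥ ∨ U = E) :
    (σ.subRep E hE).IsIrreducible := by
  haveI : Nontrivial E := (Submodule.nontrivial_iff_ne_bot).mpr hne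
  refine Literature.NumberTheory.Automorphic.isIrreducible_of_intertwiningMap_injective
    σ.toRepresentation (σ.subRepSubtype E hE) Subtype.val_injective fun U hU hUle ↦ ?_
  have hrange : LinearMap.range (σ.subRepSubtype E hE).toLinearMap = E := Submodule.range_subtype E
  rw [hrange] at hUle ⊢
  exact hmin U (fun k u hu ↦ hU k u hu) hUle

/-- **Admissibility on irreducible `K`-types gives finite multiplicity of every finite-dimensional
stable subspace.** Let `σ` be unitary and `ρ` any representation of `K`. If `dim Hom_K(E, ρ) < ∞`
for every finite-dimensional `σ`-stable `E ≤ H` on which `σ` is irreducible, then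
`dim Hom_K(F, ρ) < ∞` for every finite-dimensional `σ`-stable `F ≤ H`. Induction on `dim F`: pick a
minimal non-zero stable `E ≤ F` (irreducible), split `F = E ⊕ (Eᗮ ⊓ F)` (unitarity), and restrict.
Wallach, §1.4.6–1.4.7 and §3.3.1. [cite: WallachRRG1, §3.3.1] -/
theorem IsUnitary.finiteDimensional_intertwiningMap_of_irreducible (hσ : σ.IsUnitary)
    {V : Type*} [AddCommGroup V] [Module ℂ V] (ρ : Representation ℂ K V)
    (hadm : ∀ (E : Submodule ℂ H) (hE : ∀ k, ∀ v ∈ E, σ k v ∈ E), FiniteDimensional ℂ E →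
      (σ.subRep E hE).IsIrreducible → FiniteDimensional ℂ ((σ.subRep E hE).IntertwiningMap ρ))
    (F : Submodule ℂ H) [FiniteDimensional ℂ F] (hF : ∀ k, ∀ v ∈ F, σ k v ∈ F) :
    FiniteDimensional ℂ ((σ.subRep F hF).IntertwiningMap ρ) := by
  -- strong induction on the dimension of `F`
  suffices h : ∀ (m : ℕ) (F : Submodule ℂ H) (hF : ∀ k, ∀ v ∈ F, σ k v ∈ F),
      FiniteDimensional ℂ F → Module.finrank ℂ F ≤ m →
        FiniteDimensional ℂ ((σ.subRep F hF).IntertwiningMap ρ) from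
    h _ F hF inferInstance le_rfl
  intro m
  induction m with
  | zero =>
    intro F hF _ hm
    have hF0 : F = ⊥ := Submodule.finrank_eq_zero.mp (Nat.le_zero.mp hm)
    haveI : Subsingleton F := by
      rw [hF0]
      infer_instance
    haveI : Subsingleton ((σ.subRep F hF).IntertwiningMap ρ) :=
      ⟨fun f g ↦ Representation.IntertwiningMap.ext (LinearMap.ext fun v ↦ by
        rw [Subsingleton.elim v 0, map_zero, map_zero])⟩
    infer_instance
  | succ m ih =>
    intro F hF _ hm
    by_cases hF0 : F = ⊥
    · exact ih F hF inferInstance (by rw [hF0, finrank_bot]; exact Nat.zero_le _)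
    -- a minimal non-zero stable `E ≤ F`, irreducible
    obtain ⟨E, hEF, hEne, hEK, hEmin⟩ :=
      Literature.NumberTheory.Automorphic.exists_minimal_stable_submodule σ.toRepresentation F hF0
        (fun k w hw ↦ hF k w hw)
    haveI : FiniteDimensional ℂ E := Submodule.finiteDimensional_of_le hEF
    have hirr : (σ.subRep E hEK).IsIrreducible :=
      isIrreducible_subRep_of_minimal hEK hEne fun U hU hUle ↦ hEmin U hU hUle
    haveI hfinE : FiniteDimensional ℂ ((σ.subRep E hEK).IntertwiningMap ρ) :=
      hadm E hEK inferInstance hirr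
    -- its orthogonal complement inside `F`, stable and of smaller dimension
    set E' : Submodule ℂ H := Eᗮ ⊓ F with hE'_def
    have hE'K : ∀ k, ∀ v ∈ E', σ k v ∈ E' := fun k v hv ↦
      ⟨hσ.apply_mem_orthogonal hEK k hv.1, hF k v hv.2⟩
    haveI : FiniteDimensional ℂ E' := Submodule.finiteDimensional_of_le (inf_le_right : E' ≤ F)
    have hdim : Module.finrank ℂ E + Module.finrank ℂ E' = Module.finrank ℂ F :=
      Submodule.finrank_add_inf_finrank_orthogonal hEF
    have hEpos : 0 < Module.finrank ℂ E := by
      rw [pos_iff_ne_zero, Ne, Submodule.finrank_eq_zero]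
      exact hEne
    haveI hfinE' : FiniteDimensional ℂ ((σ.subRep E' hE'K).IntertwiningMap ρ) :=
      ih E' hE'K inferInstance (by omega)
    -- restriction to `E` and `E'` is jointly injective
    let resE : (σ.subRep F hF).IntertwiningMap ρ →ₗ[ℂ] (σ.subRep E hEK).IntertwiningMap ρ :=
      (Representation.IntertwiningMap.llcomp (σ.subRep E hEK) (σ.subRep F hF) ρ).flip
        (σ.subRepInclusion hEK hF hEF)
    let resE' : (σ.subRep F hF).IntertwiningMap ρ →ₗ[ℂ] (σ.subRep E' hE'K).IntertwiningMap ρ :=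
      (Representation.IntertwiningMap.llcomp (σ.subRep E' hE'K) (σ.subRep F hF) ρ).flip
        (σ.subRepInclusion hE'K hF inf_le_right)
    refine Module.Finite.of_injective (resE.prod resE') fun T₁ T₂ h ↦ ?_
    have h₁ : resE T₁ = resE T₂ := congrArg Prod.fst h
    have h₂ : resE' T₁ = resE' T₂ := congrArg Prod.snd h
    refine Representation.IntertwiningMap.ext (LinearMap.ext fun v ↦ ?_)
    -- `v = e + e'` with `e ∈ E`, `e' ∈ E'`
    have he : (E.starProjection (v : H)) ∈ E := E.starProjection_apply_mem _
    have he' : (v : H) - E.starProjection (v : H) ∈ E' :=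
      ⟨E.sub_starProjection_mem_orthogonal _, F.sub_mem v.2 (hEF he)⟩
    have hv : v = σ.subRepInclusion hEK hF hEF ⟨_, he⟩ +
        σ.subRepInclusion hE'K hF inf_le_right ⟨_, he'⟩ := by
      apply Subtype.ext
      simp
    have k₁ : ∀ e : E, T₁ (σ.subRepInclusion hEK hF hEF e) = T₂ (σ.subRepInclusion hEK hF hEF e) :=
      fun e ↦ congrArg (fun T : (σ.subRep E hEK).IntertwiningMap ρ ↦ T e) h₁
    have k₂ : ∀ e : E', T₁ (σ.subRepInclusion hE'K hF inf_le_right e) =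
        T₂ (σ.subRepInclusion hE'K hF inf_le_right e) :=
      fun e ↦ congrArg (fun T : (σ.subRep E' hE'K).IntertwiningMap ρ ↦ T e) h₂
    rw [Representation.IntertwiningMap.toLinearMap_apply,
      Representation.IntertwiningMap.toLinearMap_apply, hv, map_add, map_add, k₁, k₂]

end ContRepresentation
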